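import Mathlib
import Summits.ValiantsHypothesis.ValiantsHypothesis.Theses.NewtonUnitEquations
import Literature.Computability.AlgebraicComplexity.NewtonPolygonTau

/-!
# Crux-plan verdict file for idea `group-fibre-trellis` on crux `NewtonUnitEquations.NewtonTauWeak`
(stmt-ValiantsHypothesis-5904) — **NO CONCLUDING SKELETON**; bankable statements and the no-go lemma

Planner `planner-cruxplan-stmt-ValiantsHypothesis-5904-group-fibre-trellis-0`, 2026-08-16.
This is NOT a registered skeleton (there is deliberately no `NewtonTauWeak_of`).  It records, as
elaborating Lean statements (proofs `sorry` where marked; §3's small-case sanity check is kernel-checked by `decide`):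

* §1 the card's lever as a statement: `fibreImage`, `VS`, and the divide-and-conquer bound
  `groupFibre_shadow_bound` (PROVABLE NOW, |G|-dependent: `(t+1)(2|G|+2)^(clog₂ m + 1)`);
* §2 TORSION UNIVERSALITY `newtonTauWeak_of_finite` (PROVABLE NOW, M-sized): the crux over `ℂ`
  follows from the same bound over all FINITE fields with uniform constants — so "coefficients are
  roots of unity" is not a sub-regime but a normal form of the whole crux, with the effective group
  `(ℤ/(q-1))^(k-1)` of UNCONTROLLED order;
* §3 the NO-GO `not_groupFibreShadowUniform`: a |G|-UNIFORM fibre bound of the weak shape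
  `2^(a m)(t+2)^c` is FALSE — one cyclic equation of modulus `Q = 2(2b)^(2n²-n)` on an `m = n²`
  -position frame with `t = b²` letters per position carves exactly `b^n` tuples whose planar image
  is a perturbed parabola `{(B y² + ε(y), y) : y < b^n}`, i.e. `b^n = t^(√m/2)` hull vertices
  (exhaustively verified for `(n,b) ∈ {(1,2),(1,3),(2,2),(2,3),(3,2)}` by `kit/parabola_fibre.py`,
  and for `(2,2)` by the `decide`d theorems `Gadget.card_tuples_fibre` / `Gadget.image_eq` below).

Consequence (the verdict): every route from the general crux to group fibres lands with `|G|`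
uncontrolled (§2; likewise the unit-equation structure in characteristic 0, `Γ ≅ ℤ^r ⊕ torsion`),
and by §3 no `|G|`-free fibre statement can be true, so a composition `stubs → NewtonTauWeak` along
this idea needs a stub of the strength of the crux on dissociated frames — a costume.  The lever
remains a valid REGIME tool (bounded torsion, dissociated, `|G| ≤ 2^(O(m/log m))`) and negative
knowledge for the disprover, exactly as the triage panel graded it.
-/

set_option linter.dupNamespace false
set_option linter.unusedVariables false

namespace Summit.ValiantsHypothesis.ValiantsHypothesis.Cruxes.NewtonTauWeak.GroupFibreTrellis

open scoped BigOperators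
open Summit.ValiantsHypothesis.ValiantsHypothesis.Theses.NewtonUnitEquations (NewtonTauWeak)
open Literature.Computability.AlgebraicComplexity (newtonVertexCount)

noncomputable section

/-! ## §1 The lever: group-fibred sumsets and the divide-and-conquer bound (|G|-dependent) -/

/-- Hull-vertex count of a finite planar lattice set (the crux's expression on a `Finset`). -/
def VS (S : Finset (Fin 2 →₀ ℕ)) : ℕ :=
  (Set.extremePoints ℝ (convexHull ℝ ((fun e : Fin 2 →₀ ℕ => fun i : Fin 2 => ((e i : ℕ) : ℝ)) ''
    (S : Set (Fin 2 →₀ ℕ))))).ncard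

/-- The planar image of the group fibre `F_g = {a ∈ Π_j A_j : Σ_j ψ_j(a_j) = g}` under `a ↦ Σ_j a_j`. -/
def fibreImage {m : ℕ} {G : Type} [AddCommGroup G] [DecidableEq G]
    (A : Fin m → Finset (Fin 2 →₀ ℕ)) (ψ : Fin m → (Fin 2 →₀ ℕ) → G) (g : G) :
    Finset (Fin 2 →₀ ℕ) :=
  ((Fintype.piFinset A).filter (fun a => ∑ j, ψ j (a j) = g)).image (fun a => ∑ j, a j)

/-- **The card's first lemma (provable now; triage r1-1/2/3 re-derived it).**  Divide and conquer on
a balanced split of `Fin m`: `conv F_J^(g) = conv ⋃_(g₁) (F_(J₁)^(g₁) + F_(J₂)^(g-g₁))`, extreme points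
of a union lie in a part, `#vert(P+Q) ≤ #vert P + #vert Q` in the plane, so
`v(m) ≤ |G|·(v⌈m/2⌉ + v⌊m/2⌋)`.  The bound is POLYNOMIAL IN |G| and quasi-polynomial in `m`; it is
the whole positive content of the idea.  Not a stub of a line on this crux (see §2–§3); bank it as a
support lemma for crux stmt-5905 (DissociatedUniform: it retires cyclic residue designs of modulus
`q ≤ 2^(m/log₂ m)` for the WEAK shape) and as negative knowledge for the disprover. -/
theorem groupFibre_shadow_bound (m t : ℕ) (G : Type) [AddCommGroup G] [Fintype G] [DecidableEq G]
    (A : Fin m → Finset (Fin 2 →₀ ℕ)) (ψ : Fin m → (Fin 2 →₀ ℕ) → G) (g : G)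
    (hA : ∀ j, (A j).card ≤ t) :
    VS (fibreImage A ψ g) ≤ (t + 1) * (2 * Fintype.card G + 2) ^ (Nat.clog 2 m + 1) := by
  sorry

/-! ## §2 Torsion universality: WLOG the coefficient field is finite (provable now, M-sized) -/

/-- The crux's bound over ALL finite fields with uniform constants. -/
def NewtonTauWeakFinite : Prop :=
  ∃ a b : ℕ, ∀ (F : Type) [Field F] [Fintype F] (k m t : ℕ)
    (f : Fin k → Fin m → MvPolynomial (Fin 2) F),
    (∀ i j, (f i j).support.card ≤ t) →
      newtonVertexCount (∑ i, ∏ j, f i j) ≤ 2 ^ (a * m) * (k * t + 2) ^ b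

/-- **Torsion universality (specialisation).**  `NewtonTauWeakFinite → NewtonTauWeak` with the same
constants.  Proof to formalise: the coefficients of all `f i j` generate a finitely generated
`ℤ`-subalgebra `R ⊆ ℂ` (a Jacobson domain); the finitely many NONZERO coefficients of
`F = Σ_i Π_j f i j` lie in `R`, their product `x ≠ 0` is not in the Jacobson radical `= 0`, so some
maximal ideal `𝔪 ∌ x`, and `R/𝔪` is a FINITE field (a field of finite type over `ℤ`) — or, avoiding
the Jacobson radical: any maximal ideal of the nonzero finite-type `ℤ`-algebra `R[1/x]` has finite
residue field and `x` maps to a unit (Mathlib handle for "finite-type field over `ℤ` is finite": Zariski's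
lemma `finite_of_finite_type_of_isJacobsonRing`, stacks 0CY7, with `R = ℤ`, then positive characteristic
and finiteness over `𝔽_p`); the reduction `π : R → R/𝔪` maps `F` to `Σ_i Π_j π(f i j)` with `supp π(f i j) ⊆ supp (f i j)` (`card ≤ t`) and
`supp π(F) = supp F` exactly (`coeff_map`; nonzero coefficients stay nonzero by the choice of `𝔪`),
hence the same Newton polygon.  Consequence for THIS idea: over `𝔽_q` every nonzero coefficient is a
root of unity, so the card's torsion dictionary applies to EVERY instance — with effective group
`(ℤ/(q-1))^(k-1)` whose order is not bounded by any function of `k, m, t`.  (Status of the converse /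
of `NewtonTauWeakFinite` itself: at least as strong as the crux; no characteristic-`p` counterexample
is known to this seat; Frobenius `g ↦ g^p` preserves sparsity and is the obvious risk.) -/
theorem newtonTauWeak_of_finite : NewtonTauWeakFinite → NewtonTauWeak := by
  sorry

/-! ## §3 The no-go: a |G|-uniform fibre bound of the weak shape is false -/

/-- The `|G|`-FREE version of the fibre bound in the crux's weak shape (what a concluding line through
group fibres would need after §2): hull vertices of a single fibre `≤ 2^(a m)(t+2)^c` for every finite
abelian group. -/
def GroupFibreShadowUniform : Prop :=
  ∃ a c : ℕ, ∀ (m t : ℕ) (G : Type) [AddCommGroup G] [Fintype G] [DecidableEq G]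
    (A : Fin m → Finset (Fin 2 →₀ ℕ)) (ψ : Fin m → (Fin 2 →₀ ℕ) → G) (g : G),
    (∀ j, (A j).card ≤ t) → VS (fibreImage A ψ g) ≤ 2 ^ (a * m) * (t + 2) ^ c

/-- **Parabola fibre (no-go).**  `GroupFibreShadowUniform` is FALSE.  Construction (paper proof;
exhaustive machine check for small `(n,b)` in `kit/parabola_fibre.py`; `(2,2)` kernel-checked in `Gadget` below): digits
`y = Σ_(k<n) y_k b^k`; positions `p = (k,l) ∈ [n]²` (`m = n²`); letters at `p` are pairs
`(u,v) ∈ [b]²` (`t = b²`) realised as the DISTINCT planar points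
`a_p(u,v) = (B·u·v·b^(k+l) + (u + b·v), [l = 0]·u·b^k)`, `B = 2n²b² + 1`; consistency constraints
`u_(k,l) = u_(k,0)` (`l ≥ 1`) and `v_(k,l) = u_(l,0)` — `r = 2n² - n` differences of digit functions,
each in `(-b, b)` — are aggregated into ONE equation `Σ_p ψ_p(a_p) = 0` in `ℤ/Q`,
`ψ_p(u,v) = Σ_(s ∋ p) ± M^s·(u or v)`, `M = 2b`, `Q = 2M^r` (balanced base-`M` digits: the sum
vanishes iff every constraint holds).  The fibre is exactly the `b^n` consistent tuples
`(u,v)_(k,l) = (y_k, y_l)`, with image `(Σ_(k,l) B y_k y_l b^(k+l) + ε(y), Σ_k y_k b^k) = (B y² + ε(y), y)`,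
`0 ≤ ε(y) ≤ n²(b²-1) < B/2`, a strictly convex function of `y`; so all `b^n` image points are hull
vertices.  Against `2^(a n²)(b²+2)^c` take `b = 2^(2an)` and `n > 4c + 1`.  (`log₂|G| ≤ (2n²-n+1)·
log₂(4b)`: the card's POLYNOMIAL-in-|G| conjecture `GroupFibreShadowPoly` is untouched — here
`#vertices = b^n ≤ |G|`.) -/
theorem not_groupFibreShadowUniform : ¬ GroupFibreShadowUniform := by
  sorry

end

/-! ### Machine sanity check of the gadget at `(n,b) = (2,2)` (kernel-checked by `decide`; all in `ℕ`,
subtraction mod `Q` written as `+ (Q - ·)`) -/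

namespace Gadget

/-- digits `n = 2`, base `b = 2`. -/
def nn : ℕ := 2
def bb : ℕ := 2
/-- positions `(k,l)` and letters `(u,v)`. -/
def positions : List (ℕ × ℕ) := [(0,0),(0,1),(1,0),(1,1)]
def letters : List (ℕ × ℕ) := [(0,0),(0,1),(1,0),(1,1)]
/-- constraints `(p⁺, component⁺, p⁻, component⁻)`: `u_(k,l) = u_(k,0)` for `l ≥ 1`, `v_(k,l) = u_(l,0)`. -/
def cons : List ((ℕ × ℕ) × ℕ × (ℕ × ℕ) × ℕ) :=
  (positions.filterMap fun p => if p.2 ≥ 1 then some (p, 0, (p.1, 0), 0) else none) ++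
  (positions.map fun p => (p, 1, (p.2, 0), 0))
def M : ℕ := 2 * bb
def Q : ℕ := 2 * M ^ cons.length
def comp (uv : ℕ × ℕ) (c : ℕ) : ℕ := if c = 0 then uv.1 else uv.2
/-- the aggregated table `ψ_p(u,v) ∈ ℤ/Q`, represented in `[0,Q)` (a term `-M^s·w` is written `+ (Q - M^s·w)`). -/
def psi (p : ℕ × ℕ) (uv : ℕ × ℕ) : ℕ :=
  ((List.range cons.length).foldl (fun acc s =>
      match cons[s]? with
      | some (pp, cp, pm, cm) =>
          acc + (if pp = p then M ^ s * comp uv cp else 0) + (if pm = p then Q - M ^ s * comp uv cm else 0)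
      | none => acc) 0) % Q
def Bc : ℕ := 2 * nn * nn * bb * bb + 1
/-- planar letter `a_p(u,v)`. -/
def vec (p : ℕ × ℕ) (uv : ℕ × ℕ) : ℕ × ℕ :=
  (Bc * uv.1 * uv.2 * bb ^ (p.1 + p.2) + (uv.1 + bb * uv.2), if p.2 = 0 then uv.1 * bb ^ p.1 else 0)
/-- all `t^m = 256` tuples. -/
def tuples : List (List (ℕ × ℕ)) :=
  positions.foldr (fun _ acc => letters.flatMap fun uv => acc.map fun tl => uv :: tl) [[]]
/-- the fibre `{Σ_p ψ_p ≡ 0 mod Q}` and its planar image. -/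
def fibre : List (List (ℕ × ℕ)) :=
  tuples.filter fun tup => ((List.zip positions tup).foldl (fun acc q => acc + psi q.1 q.2) 0) % Q = 0
def image : List (ℕ × ℕ) :=
  fibre.map fun tup => (List.zip positions tup).foldl
    (fun acc q => (acc.1 + (vec q.1 q.2).1, acc.2 + (vec q.1 q.2).2)) (0, 0)

set_option maxRecDepth 200000 in
/-- `t^m = 256` tuples, of which exactly `4 = b^n` lie in the fibre. -/
theorem card_tuples_fibre : tuples.length = 256 ∧ fibre.length = 4 := by decide +kernel

set_option maxRecDepth 200000 in
/-- The fibre's planar image is the perturbed parabola `(33·y² + ε(y), y)`, `y = 0,2,1,3` in enumeration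
order, `ε = 0, 6, 6, 12 < 33/2`: four points in strictly convex position. -/
theorem image_eq : image = [(0, 0), (138, 2), (39, 1), (309, 3)] := by decide +kernel

end Gadget

end Summit.ValiantsHypothesis.ValiantsHypothesis.Cruxes.NewtonTauWeak.GroupFibreTrellis
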